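import Literature.MathematicalPhysics.QuantumFieldTheory.Balaban1983to89.Beta.AveragingHessianKernelsRooted

/-!
# `BalabanUV.Beta.AveragingBorderLoops` — binder row D1, (L4): THE CENTRE-ROOTED AVERAGING LOOPS READ ON THE TWO ROOT BONDS
# `(τ, ρ_c)`, `(σ, ρ_c)` (part 1 of 2 of the counting witness `vhSAt_ne_zero` WANTED by the row-D1 owner an2-g19, journal
# l.13361 (3), for `SecondOrderBorderNoModel.no_twin_border_model`; referee beta-d1-formalise-ref #11 I-d1ref11-1 / beta-cap-ref #80)

HONEST FRAMING (cell charter, verbatim): «discharging BetaPertH makes Balaban's UV stability UNCONDITIONAL — a real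
constructive-QFT result; it is NOT the continuum limit and NOT the Clay problem.»  This module is [folklore] list / `Finset`
combinatorics of an1's node-5 / 5ρ / 7a / 7aρ objects (`Literature.….Beta.AveragingContours(Rooted)`,
`….AveragingHessianKernels(Rooted)`: `segUp`, `segDown`, `seg`, `corner`, `axialAux`, `axial`, `rev`, `gammaCAt`, `loopCAt`, `ctr`,
`δ1`, `pairForm`, `bg`/`fl`, `LettersIn`/`Hull`, `mem_segUp`/`mem_segDown`/`lettersIn_axial`), used BY NAME and never restated; no
statement of Bałaban's papers, no `[cite:]`, no `def`, no `Prop` fact; it instantiates NO binder of the wall (0/4: hW, hR, D1Tel,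
D1Rep).  NOT D1, NOT `BetaPertH`, NOT continuum, NOT Clay.
HONEST DEPENDENCY: continuum YM on T⁴ ⇐ BetaPertH ∧ nine spine estimates (0/9 proved); BetaPertH ⇐ (D1) ∧ (D4) ∧ CAP+tail;
G-an2-4 gates asym, D1 and NE2/3/4.

## What is proved (node-5 dimension `e + 3`, i.e. an2's `d = e + 2`; root `ρ_c = ctr (e+3) L`, `c := (L−1)/2`; coarse bond `(μ, 0)`;
## `τ` the LAST axis (`τ = e + 2`, the first one node 5's `axial` moves), `σ = e + 1` the second-last)
* §1 letter lemmas for indicator forms `δ1 g`: a `segUp`/`segDown`/`seg` of another direction, or missing the bond's base point, has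
  only zero letters; the letters of `axialAux A y x m` have directions `< m`; `rev` and `LettersIn` transfer; the straight `+κ`
  segment from the base point of a `κ`-bond meets it exactly once (`sum_segUp_δ1_self`); first/second-letter projections
  `bg`/`fl (loopCAt ρ (pairForm B A) …) = loopCAt ρ B/A …`.
* §2 for every block point `b` (`1 ≤ L`, `μ ≠ τ` resp. `μ ≠ σ`): every letter of the rooted loop `Γ^{ρ_c}_{c,b} ∪ (−c)` read on
  `δ1 (τ, ρ_c)` vanishes unless `c < b τ` (`loopCAt_δ1_last`), read on `δ1 (σ, ρ_c)` vanishes unless `b τ = c`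
  (`loopCAt_δ1_second`) — so NO loop carries both bonds —, and the letter SUMS of the contour `Γ^{ρ_c}_{c,b}` are the indicators
  `[c < b τ]` (`sum_gammaCAt_δ1_last`) and `[b τ = c ∧ c < b σ]` (`sum_gammaCAt_δ1_second`): each bond is passed at most once, forwards.
Part 2 (`Beta.AveragingBorderWitness`) turns this into `hessCountAt = 0`, `0 < linCountAt`, `vhCountAt < 0` and the non-zero entry.
Provenance: β sub-cell, D1 formalisation swarm, unit b2b-balaban-beta-d1-formalise-leaf-04 gen 3, 2026-08-20 (v1); no existing file
touched.
-/

open Finset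
open Literature.MathematicalPhysics.QuantumFieldTheory.Balaban1983to89.Beta
open Literature.MathematicalPhysics.QuantumFieldTheory.Balaban1983to89.Beta.AffineAveraging
open Literature.MathematicalPhysics.QuantumFieldTheory.Balaban1983to89.Beta.AveragingContours
open Literature.MathematicalPhysics.QuantumFieldTheory.Balaban1983to89.Beta.AveragingContoursRooted
open Literature.MathematicalPhysics.QuantumFieldTheory.Balaban1983to89.Beta.TransportedContourVariables
open Literature.MathematicalPhysics.QuantumFieldTheory.Balaban1983to89.Beta.AveragingHessianKernels
open Literature.MathematicalPhysics.QuantumFieldTheory.Balaban1983to89.Beta.AveragingHessianKernelsRooted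

namespace Summit.QuantumFields.BalabanUV.Beta.AveragingBorderLoops

/-! ## §1 Letters of indicator forms on node 5's contour pieces -/

section Letters

variable {D : ℕ}

/-- [folklore] A straight `+κ` segment read on the indicator of a bond of another direction has only zero letters. -/
theorem segUp_δ1_of_ne {g : Bond D} {κ : Fin D} (h : g.1 ≠ κ) (z : Site D) (n : ℕ) :
    ∀ a ∈ segUp (δ1 g) z κ n, a = 0 := by
  intro a ha
  obtain ⟨s, -, rfl⟩ := mem_segUp ha
  rw [δ1_apply, if_neg]
  intro e
  exact h (by rw [← e])

/-- [folklore] A straight `−κ` segment read on the indicator of a bond of another direction has only zero letters. -/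
theorem segDown_δ1_of_ne {g : Bond D} {κ : Fin D} (h : g.1 ≠ κ) (z : Site D) (n : ℕ) :
    ∀ a ∈ segDown (δ1 g) z κ n, a = 0 := by
  intro a ha
  obtain ⟨s, -, rfl⟩ := mem_segDown ha
  rw [δ1_apply, if_neg, neg_zero]
  intro e
  exact h (by rw [← e])

/-- [folklore] A signed segment read on the indicator of a bond of another direction has only zero letters. -/
theorem seg_δ1_of_ne {g : Bond D} {κ : Fin D} (h : g.1 ≠ κ) (z : Site D) (n : ℤ) :
    ∀ a ∈ seg (δ1 g) z κ n, a = 0 := by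
  unfold seg
  split_ifs
  · exact segUp_δ1_of_ne h z _
  · exact segDown_δ1_of_ne h z _

/-- [folklore] A straight `+κ` segment missing the base point of the bond has only zero letters. -/
theorem segUp_δ1_of_forall_ne {g : Bond D} {z : Site D} {κ : Fin D} {n : ℕ}
    (h : ∀ s : ℕ, s < n → z + (s : ℤ) • unitVec κ ≠ g.2) : ∀ a ∈ segUp (δ1 g) z κ n, a = 0 := by
  intro a ha
  obtain ⟨s, hs, rfl⟩ := mem_segUp ha
  rw [δ1_apply, if_neg]
  intro e
  exact h s hs (by rw [← e])

/-- [folklore] A straight `−κ` segment missing the base point of the bond has only zero letters. -/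
theorem segDown_δ1_of_forall_ne {g : Bond D} {z : Site D} {κ : Fin D} {n : ℕ}
    (h : ∀ s : ℕ, s < n → z - ((s : ℤ) + 1) • unitVec κ ≠ g.2) : ∀ a ∈ segDown (δ1 g) z κ n, a = 0 := by
  intro a ha
  obtain ⟨s, hs, rfl⟩ := mem_segDown ha
  rw [δ1_apply, if_neg, neg_zero]
  intro e
  exact h s hs (by rw [← e])

/-- [folklore] The letters of `axialAux A y x m` have directions `< m`: read on the indicator of a bond of direction `≥ m`
they all vanish. -/
theorem axialAux_δ1_of_le {g : Bond D} (y x : Site D) : ∀ m : ℕ, m ≤ (g.1 : ℕ) → ∀ a ∈ axialAux (δ1 g) y x m, a = 0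
  | 0, _ => by simp [axialAux]
  | m + 1, hm => by
    intro a ha
    simp only [axialAux] at ha
    rw [List.mem_append] at ha
    rcases ha with ha | ha
    · split_ifs at ha with h
      · exact seg_δ1_of_ne (fun e => by rw [e] at hm; simp at hm) _ _ a ha
      · simp at ha
    · exact axialAux_δ1_of_le y x m (by omega) a ha

/-- [folklore] `rev` preserves «all letters vanish». -/
theorem rev_of_forall_eq_zero {R : Type*} [AddCommGroup R] {l : List R} (h : ∀ a ∈ l, a = 0) : ∀ a ∈ rev l, a = 0 := by
  intro a ha
  unfold AveragingContours.rev at ha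
  rw [List.mem_reverse] at ha
  obtain ⟨b, hb, rfl⟩ := List.mem_map.1 ha
  rw [h b hb, neg_zero]

/-- [folklore] An indicator form read on a list living in a region avoiding the bond's base point has only zero letters. -/
theorem forall_eq_zero_of_lettersIn {P : Site D → Prop} {g : Bond D} (hg : ¬ P g.2) {l : List ℤ}
    (h : LettersIn (δ1 g) P l) : ∀ a ∈ l, a = 0 := by
  intro a ha
  obtain ⟨κ, x, hx, ha⟩ := h a ha
  have h0 : δ1 g κ x = 0 := by
    rw [δ1_apply, if_neg]
    rintro rfl
    exact hg hx
  rcases ha with ha | ha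
  · rw [ha, h0]
  · rw [ha, h0, neg_zero]

/-- [folklore] A list all of whose letters vanish sums to `0`. -/
theorem sum_eq_zero_of_forall {l : List ℤ} (h : ∀ a ∈ l, a = 0) : l.sum = 0 := List.sum_eq_zero h

/-- [folklore] The straight `+κ` segment FROM the base point of a `κ`-bond meets it exactly once (if non-empty). -/
theorem sum_segUp_δ1_self (z : Site D) (κ : Fin D) :
    ∀ n : ℕ, (segUp (δ1 (κ, z)) z κ n).sum = if 0 < n then 1 else 0
  | 0 => by simp
  | n + 1 => by
    rw [segUp_succ, List.sum_append, List.sum_singleton, sum_segUp_δ1_self z κ n, δ1_apply]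
    have e : ((κ, z + (n : ℤ) • unitVec κ) = (κ, z)) ↔ n = 0 := by
      constructor
      · intro h
        have h' := congrFun (Prod.mk.inj h).2 κ
        simp at h'
        omega
      · rintro rfl; simp
    rw [if_congr e rfl rfl]
    rcases Nat.eq_zero_or_pos n with h | h
    · subst h; simp
    · rw [if_pos h, if_neg (by omega), if_pos (by omega)]; ring

/-- [folklore] The first-letter projection of a rooted loop read on a pair form is the loop read on the first form. -/
theorem bg_loopCAt_pairForm {R : Type*} [AddCommGroup R] (ρ : Site D) (B A : Form1 D R) (L : ℕ) (μ : Fin D)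
    (y : Site D) (b : Fin D → ℕ) : bg (loopCAt ρ (pairForm B A) L μ y b) = loopCAt ρ B L μ y b := by
  have h := loopCAt_map (AddMonoidHom.fst R R) ρ (pairForm B A) L μ y b
  have e : mapForm (AddMonoidHom.fst R R) (pairForm B A) = B := by funext κ x; rfl
  rw [e] at h
  rw [← h]
  rfl

/-- [folklore] The second-letter projection of a rooted loop read on a pair form is the loop read on the second form. -/
theorem fl_loopCAt_pairForm {R : Type*} [AddCommGroup R] (ρ : Site D) (B A : Form1 D R) (L : ℕ) (μ : Fin D)
    (y : Site D) (b : Fin D → ℕ) : fl (loopCAt ρ (pairForm B A) L μ y b) = loopCAt ρ A L μ y b := by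
  have h := loopCAt_map (AddMonoidHom.snd R R) ρ (pairForm B A) L μ y b
  have e : mapForm (AddMonoidHom.snd R R) (pairForm B A) = A := by funext κ x; rfl
  rw [e] at h
  rw [← h]
  rfl

/-- [folklore] If the loop read on the first indicator has only zero letters, the pair-read loop has zero first letters. -/
theorem fst_loopCAt_eq_zero {ρ : Site D} {f f' : Bond D} {L : ℕ} {μ : Fin D} {y : Site D} {b : Fin D → ℕ}
    (h : ∀ a ∈ loopCAt ρ (δ1 f) L μ y b, a = 0) : ∀ p ∈ loopCAt ρ (pairForm (δ1 f) (δ1 f')) L μ y b, p.1 = 0 := by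
  intro p hp
  apply h
  rw [← bg_loopCAt_pairForm ρ (δ1 f) (δ1 f') L μ y b]
  exact List.mem_map.2 ⟨p, hp, rfl⟩

/-- [folklore] If the loop read on the second indicator has only zero letters, the pair-read loop has zero second letters. -/
theorem snd_loopCAt_eq_zero {ρ : Site D} {f f' : Bond D} {L : ℕ} {μ : Fin D} {y : Site D} {b : Fin D → ℕ}
    (h : ∀ a ∈ loopCAt ρ (δ1 f') L μ y b, a = 0) : ∀ p ∈ loopCAt ρ (pairForm (δ1 f) (δ1 f')) L μ y b, p.2 = 0 := by
  intro p hp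
  apply h
  rw [← fl_loopCAt_pairForm ρ (δ1 f) (δ1 f') L μ y b]
  exact List.mem_map.2 ⟨p, hp, rfl⟩

end Letters

/-! ## §2 The centre-rooted loops read on the two bonds at the root -/

section Centre

variable {e L : ℕ} {τ σ μ : Fin (e + 3)}

/-- [folklore] An axial contour all of whose base points have `μ`-coordinate above that of the bond misses the bond. -/
theorem axial_δ1_of_lt {D : ℕ} {g : Bond D} {ν : Fin D} {y x : Site D} (hy : g.2 ν < y ν) (hx : g.2 ν < x ν) :
    ∀ a ∈ axial (δ1 g) y x, a = 0 :=
  forall_eq_zero_of_lettersIn (P := Hull y x)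
    (fun hH => by have h1 := (hH ν).1; rw [min_le_iff] at h1; omega) (lettersIn_axial _ y x)

/-- [folklore] Node 5's axial contour in dimension `e + 3` starts with the segment moving the LAST coordinate `τ = e + 2`
from the initial point. -/
theorem axial_last {R : Type*} [AddCommGroup R] (A : Form1 (e + 3) R) (y x : Site (e + 3)) (hτ : (τ : ℕ) = e + 2) :
    axial A y x = seg A y τ (x τ - y τ) ++ axialAux A y x (e + 2) := by
  have hlt : e + 2 < e + 3 := by omega
  have hτ' : (⟨e + 2, hlt⟩ : Fin (e + 3)) = τ := Fin.ext hτ.symm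
  show axialAux A y x (e + 2 + 1) = _
  rw [axialAux, dif_pos hlt, corner_of_le y x (by omega : e + 3 ≤ e + 2 + 1), hτ']

/-- [folklore] … and continues with the segment moving the coordinate `σ = e + 1` from the corner `corner y x (e+2)`. -/
theorem axialAux_second {R : Type*} [AddCommGroup R] (A : Form1 (e + 3) R) (y x : Site (e + 3))
    (hσ : (σ : ℕ) = e + 1) :
    axialAux A y x (e + 2) = seg A (corner y x (e + 2)) σ (x σ - y σ) ++ axialAux A y x (e + 1) := by
  have hlt : e + 1 < e + 3 := by omega
  have hσ' : (⟨e + 1, hlt⟩ : Fin (e + 3)) = σ := Fin.ext hσ.symm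
  show axialAux A y x (e + 1 + 1) = _
  rw [axialAux, dif_pos hlt, hσ']

/-- [folklore] The corner `corner y x (e+2)`: last coordinate from `x`, the others from `y`. -/
theorem corner_second_apply (y x : Site (e + 3)) (i : Fin (e + 3)) :
    corner y x (e + 2) i = if (i : ℕ) = e + 2 then x i else y i := by
  unfold corner
  have hi := i.isLt
  by_cases h : (i : ℕ) = e + 2
  · rw [if_pos (by omega), if_pos h]
  · rw [if_neg (by omega), if_neg h]

/-- [folklore] **THE LOOP READ ON THE LAST-AXIS BOND AT THE ROOT**: for the centred root `ρ_c`, coarse bond `(μ, 0)`,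
`μ ≠ τ`, and a block point `b` with `¬ c < b τ` (`c = (L−1)/2`), every letter of `Γ^{ρ_c}_{c, b} ∪ (−c)` read on
`δ1 (τ, ρ_c)` vanishes. -/
theorem loopCAt_δ1_last (hL : 1 ≤ L) (hτ : (τ : ℕ) = e + 2) (hμτ : μ ≠ τ) (b : Fin (e + 3) → ℕ)
    (hbτ : ¬ (((L - 1) / 2 : ℕ) : ℤ) < (b τ : ℤ)) :
    ∀ a ∈ loopCAt (ctr (e + 3) L) (δ1 (τ, ctr (e + 3) L)) L μ 0 b, a = 0 := by
  intro a ha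
  simp only [loopCAt, gammaCAt, smul_zero, zero_add, List.mem_append] at ha
  rcases ha with ((ha | ha) | ha) | ha
  · rw [axial_last _ _ _ hτ, List.mem_append] at ha
    rcases ha with ha | ha
    · unfold seg at ha
      split_ifs at ha with hn
      · have h0 : (toSite b τ - ctr (e + 3) L τ).toNat = 0 := by
          simp only [toSite, ctr_apply] at hn hbτ ⊢; omega
        rw [h0, segUp_zero] at ha
        simp at ha
      · refine segDown_δ1_of_forall_ne (fun s _ h => ?_) a ha
        have h1 := congrFun h τ
        simp at h1
        omega
    · exact axialAux_δ1_of_le _ _ (e + 2) (by simp [hτ]) a ha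
  · exact segUp_δ1_of_ne (g := (τ, ctr (e + 3) L)) (Ne.symm hμτ) _ _ a ha
  · refine rev_of_forall_eq_zero (axial_δ1_of_lt (ν := μ) ?_ ?_) a ha
    · have hb0 : (0 : ℤ) ≤ ((L - 1) / 2 : ℕ) := by positivity
      simp [ctr_apply, unitVec_apply]
      omega
    · simp [ctr_apply, unitVec_apply, toSite]
      omega
  · exact rev_of_forall_eq_zero (segUp_δ1_of_ne (g := (τ, ctr (e + 3) L)) (Ne.symm hμτ) _ _) a ha

/-- [folklore] **… AND ITS CONTOUR SUM IS THE INDICATOR `[c < b τ]`**: the rooted contour `Γ^{ρ_c}_{c,b}` passes through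
the bond `(τ, ρ_c)` exactly once, forwards, iff `c < b τ`. -/
theorem sum_gammaCAt_δ1_last (hL : 1 ≤ L) (hτ : (τ : ℕ) = e + 2) (hμτ : μ ≠ τ) (b : Fin (e + 3) → ℕ) :
    (gammaCAt (ctr (e + 3) L) (δ1 (τ, ctr (e + 3) L)) L μ 0 b).sum =
      if (((L - 1) / 2 : ℕ) : ℤ) < (b τ : ℤ) then 1 else 0 := by
  by_cases hc : (((L - 1) / 2 : ℕ) : ℤ) < (b τ : ℤ)
  · rw [if_pos hc]
    have hfar : (axial (δ1 (τ, ctr (e + 3) L)) (ctr (e + 3) L + (L : ℤ) • unitVec μ)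
        (toSite b + (L : ℤ) • unitVec μ)).sum = 0 := by
      refine sum_eq_zero_of_forall (axial_δ1_of_lt (ν := μ) ?_ ?_)
      · have hb0 : (0 : ℤ) ≤ ((L - 1) / 2 : ℕ) := by positivity
        simp [ctr_apply, unitVec_apply]
        omega
      · simp [ctr_apply, unitVec_apply, toSite]
        omega
    have hstr : (segUp (δ1 (τ, ctr (e + 3) L)) (toSite b) μ L).sum = 0 :=
      sum_eq_zero_of_forall (segUp_δ1_of_ne (g := (τ, ctr (e + 3) L)) (Ne.symm hμτ) _ _)
    have htail : (axialAux (δ1 (τ, ctr (e + 3) L)) (ctr (e + 3) L) (toSite b) (e + 2)).sum = 0 :=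
      sum_eq_zero_of_forall (axialAux_δ1_of_le _ _ (e + 2) (by simp [hτ]))
    simp only [gammaCAt, smul_zero, zero_add, List.sum_append, rev_sum, hfar, hstr, neg_zero, add_zero]
    rw [axial_last _ _ _ hτ, List.sum_append, htail, add_zero]
    unfold seg
    rw [if_pos (by simp only [toSite, ctr_apply]; omega), sum_segUp_δ1_self, if_pos]
    simp only [toSite, ctr_apply]
    omega
  · rw [if_neg hc]
    exact sum_eq_zero_of_forall fun a ha =>
      loopCAt_δ1_last hL hτ hμτ b hc a (by simp only [loopCAt, List.mem_append]; exact Or.inl ha)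

/-- [folklore] **THE LOOP READ ON THE SECOND-LAST-AXIS BOND AT THE ROOT**: for `μ ≠ σ` and a block point `b` with
`b τ ≠ c`, every letter of `Γ^{ρ_c}_{c, b} ∪ (−c)` read on `δ1 (σ, ρ_c)` vanishes. -/
theorem loopCAt_δ1_second (hL : 1 ≤ L) (hτ : (τ : ℕ) = e + 2) (hσ : (σ : ℕ) = e + 1) (hμσ : μ ≠ σ)
    (b : Fin (e + 3) → ℕ) (hbτ : (b τ : ℤ) ≠ (((L - 1) / 2 : ℕ) : ℤ)) :
    ∀ a ∈ loopCAt (ctr (e + 3) L) (δ1 (σ, ctr (e + 3) L)) L μ 0 b, a = 0 := by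
  have hστ : σ ≠ τ := fun h => by have := congrArg Fin.val h; omega
  intro a ha
  simp only [loopCAt, gammaCAt, smul_zero, zero_add, List.mem_append] at ha
  rcases ha with ((ha | ha) | ha) | ha
  · rw [axial_last _ _ _ hτ, List.mem_append] at ha
    rcases ha with ha | ha
    · exact seg_δ1_of_ne (g := (σ, ctr (e + 3) L)) hστ _ _ a ha
    · rw [axialAux_second _ _ _ hσ, List.mem_append] at ha
      rcases ha with ha | ha
      · unfold seg at ha
        split_ifs at ha with hn
        · refine segUp_δ1_of_forall_ne (fun s _ h => ?_) a ha
          have h1 := congrFun h τ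
          simp [corner_second_apply, hτ, toSite, ctr_apply, unitVec_apply, Ne.symm hστ] at h1
          omega
        · refine segDown_δ1_of_forall_ne (fun s _ h => ?_) a ha
          have h1 := congrFun h σ
          simp [corner_second_apply, hσ, ctr_apply, unitVec_apply] at h1
          omega
      · exact axialAux_δ1_of_le _ _ (e + 1) (by simp [hσ]) a ha
  · exact segUp_δ1_of_ne (g := (σ, ctr (e + 3) L)) (Ne.symm hμσ) _ _ a ha
  · refine rev_of_forall_eq_zero (axial_δ1_of_lt (ν := μ) ?_ ?_) a ha
    · have hb0 : (0 : ℤ) ≤ ((L - 1) / 2 : ℕ) := by positivity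
      simp [ctr_apply, unitVec_apply]
      omega
    · simp [ctr_apply, unitVec_apply, toSite]
      omega
  · exact rev_of_forall_eq_zero (segUp_δ1_of_ne (g := (σ, ctr (e + 3) L)) (Ne.symm hμσ) _ _) a ha

/-- [folklore] **… AND ITS CONTOUR SUM IS THE INDICATOR `[b τ = c ∧ c < b σ]`**: the rooted contour `Γ^{ρ_c}_{c,b}`
passes through the bond `(σ, ρ_c)` exactly once, forwards, iff `b τ = c` and `c < b σ`. -/
theorem sum_gammaCAt_δ1_second (hL : 1 ≤ L) (hτ : (τ : ℕ) = e + 2) (hσ : (σ : ℕ) = e + 1) (hμσ : μ ≠ σ)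
    (b : Fin (e + 3) → ℕ) :
    (gammaCAt (ctr (e + 3) L) (δ1 (σ, ctr (e + 3) L)) L μ 0 b).sum =
      if (b τ : ℤ) = (((L - 1) / 2 : ℕ) : ℤ) ∧ (((L - 1) / 2 : ℕ) : ℤ) < (b σ : ℤ) then 1 else 0 := by
  have hστ : σ ≠ τ := fun h => by have := congrArg Fin.val h; omega
  by_cases hbτ : (b τ : ℤ) = (((L - 1) / 2 : ℕ) : ℤ)
  · have hcor : corner (ctr (e + 3) L) (toSite b) (e + 2) = ctr (e + 3) L := by
      funext i
      rw [corner_second_apply]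
      split_ifs with h
      · have hi : i = τ := Fin.ext (h.trans hτ.symm)
        rw [hi, ctr_apply, toSite, hbτ]
      · rfl
    have hfar : (axial (δ1 (σ, ctr (e + 3) L)) (ctr (e + 3) L + (L : ℤ) • unitVec μ)
        (toSite b + (L : ℤ) • unitVec μ)).sum = 0 := by
      refine sum_eq_zero_of_forall (axial_δ1_of_lt (ν := μ) ?_ ?_)
      · have hb0 : (0 : ℤ) ≤ ((L - 1) / 2 : ℕ) := by positivity
        simp [ctr_apply, unitVec_apply]
        omega
      · simp [ctr_apply, unitVec_apply, toSite]
        omega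
    have hstr : (segUp (δ1 (σ, ctr (e + 3) L)) (toSite b) μ L).sum = 0 :=
      sum_eq_zero_of_forall (segUp_δ1_of_ne (g := (σ, ctr (e + 3) L)) (Ne.symm hμσ) _ _)
    have htop : (seg (δ1 (σ, ctr (e + 3) L)) (ctr (e + 3) L) τ (toSite b τ - ctr (e + 3) L τ)).sum = 0 :=
      sum_eq_zero_of_forall (seg_δ1_of_ne (g := (σ, ctr (e + 3) L)) hστ _ _)
    have htail : (axialAux (δ1 (σ, ctr (e + 3) L)) (ctr (e + 3) L) (toSite b) (e + 1)).sum = 0 :=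
      sum_eq_zero_of_forall (axialAux_δ1_of_le _ _ (e + 1) (by simp [hσ]))
    simp only [gammaCAt, smul_zero, zero_add, List.sum_append, rev_sum, hfar, hstr, neg_zero, add_zero]
    rw [axial_last _ _ _ hτ, List.sum_append, htop, zero_add, axialAux_second _ _ _ hσ, List.sum_append, htail,
      add_zero, hcor]
    by_cases hc : (((L - 1) / 2 : ℕ) : ℤ) < (b σ : ℤ)
    · rw [if_pos ⟨hbτ, hc⟩]
      unfold seg
      rw [if_pos (by simp only [toSite, ctr_apply]; omega), sum_segUp_δ1_self, if_pos]
      simp only [toSite, ctr_apply]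
      omega
    · rw [if_neg (fun h => hc h.2)]
      unfold seg
      split_ifs with hn
      · have h0 : (toSite b σ - ctr (e + 3) L σ).toNat = 0 := by
          simp only [toSite, ctr_apply] at hn hc ⊢; omega
        rw [h0, segUp_zero, List.sum_nil]
      · refine sum_eq_zero_of_forall (segDown_δ1_of_forall_ne fun s _ h => ?_)
        have h1 := congrFun h σ
        simp [ctr_apply, unitVec_apply] at h1
        omega
  · rw [if_neg (fun h => hbτ h.1)]
    exact sum_eq_zero_of_forall fun a ha =>
      loopCAt_δ1_second hL hτ hσ hμσ b hbτ a (by simp only [loopCAt, List.mem_append]; exact Or.inl ha)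

end Centre

end Summit.QuantumFields.BalabanUV.Beta.AveragingBorderLoops
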